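import Summits.QuantumFields.BalabanUV.T4Continuum.Support.NE7SliceCoarseDatumStraight
import Summits.QuantumFields.BalabanUV.T4Continuum.Support.NE7QuadRemL1Reduction
import HarnessLib

/-!
# NE7CoarseDatumL1Reduction — THE DIRECT ℓ¹ LETTER (DL1) OF hDL′ REDUCED TO THE LEVEL-WISE ONE-STEP REMAINDERS OF THE STRAIGHT GAUGE COPY (memo ROAD-G102 §9 STEP 2, §10)

Cell `pub-balaban`, lineage `t4-ne7-p1` (CRUX PROVER NE7 #1, owner of BINDER row NE7), gen 102; composition of `NE7SliceCoarseDatumStraight.coarseDatum_eq_neg_quadRem_sub`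
(`φ(u) = −[relIter − dirIter](R′) − dirIter(R′ − R)`), `NE7QuadRemL1Reduction.dirL1_relIter_sub_dirIter_le` (the k-fold quadratic remainder in `ℓ¹` against the level-wise
one-step remainders, k-free) and gen 95's `NE7DirIterL1Letter.dirL1_dirIter_le` (the linearised k-fold average in `ℓ¹`, k-free):
  `dirL1 φ(u) (periodBox N) ≤ C₁(d,L,k+1) · ( Σ_{i≤k} dirL1 (E_i(R′)) (periodBox (L^{k−i}·N)) + dirL1 (R′ − R) (periodBox (L^{k+1}·N)) )`,
`R = X(u) − gaugeDir W Λ`, `R′ = gaugeExtract W Λ R`, `E_i(R′) = relStep(cavgIter i W)(relIter i W R′) − cpush(cavgIter i W)(relIter i W R′)`,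
`C₁(d,L,K) = 3 + 2d·(dL(2nbRad+1)^d·3·Σ_{m<K}(L∕L^d)^m)` (k-free).  WHAT REMAINS of (DL1) for gen 103 (memo §10.3): the level-wise one-step remainders of the near-tangent
straight gauge copy in `ℓ¹` (ends∕corner form, `NE3QuadRemainderGaugeStep` ∕ `NE7OneStepCornerForm`) and the extraction defect in `ℓ¹` (ends form), against `q₁·E_w²`.
-/

set_option autoImplicit false

open scoped BigOperators Matrix.Norms.L2Operator
open NormedSpace Finset

namespace Summit.QuantumFields.BalabanUV.T4Continuum.NE7CoarseDatumL1Reduction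

open Literature.MathematicalPhysics.QuantumFieldTheory.Balaban1983to89
open B7Prop1Explicit B7Prop2Explicit MatrixLog
open T4AveragingDeficitWall (IsUnitaryCfg IsSkewDir SmallField vary Ad dirL1)
open T4AveragingDeficitWallBoundary (IsPeriodicCfg periodBox)
open AveragingDeficitPeriodicCounting (IsPeriodicDir)
open AveragingDeficitMultiLevelPrep (cpush cavgIter LevelSmall tower radIter)
open AveragingDeficitDerivCore (dirL1_nonneg)
open BlockAverageVaryHolo (nbRad)
open BlockAveragePushDirGauge (gaugeDir expGauge isPeriodicDir_gaugeDir)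
open BlockAverageGaugeExtract (gaugeExtract)
open BlockAverageGaugeExtractCfg (isSkewDir_gaugeExtract isPeriodicDir_gaugeExtract)
open BlockAverageVaryDisc (rho0)
open NE3EnergyShapes (IsUnitarySite IsPeriodicSite)
open NE3TangentCovariantTower (dirIter)
open NE3LinearisedAverageSup (curvSum)
open NE3QuadRemainderTower (relStep relIter)
open NE3FramePotBoundW (tower_eq_pow_mul levelSmall_pred)
open NE7SliceIterationState (repLog cornerLog coarseDatum)
open NE7SliceIterationStateFacts (repLog_skew repLog_periodic)
open NE7DirIterL1Letter (dirL1_dirIter_le)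
open NE7SliceCoarseDatumStraight (coarseDatum_eq_neg_quadRem_sub)
open NE7QuadRemL1Reduction (dirL1_relIter_sub_dirIter_le pushConst_le_l1PushC)

noncomputable section

variable {d : ℕ} {n : Type*} [Fintype n] [DecidableEq n] [Nonempty n]

section State

variable {L : ℕ} (hL : 2 ≤ L) (k : ℕ) {W : Site d → Fin d → (Matrix n n ℂ)ˣ} {x : ℝ} (hWu : IsUnitaryCfg W) (hx : 0 ≤ x) (hsK : LevelSmall d L (k + 1) x)
  (hWx : SmallField W x) (N : ℕ) [NeZero N] (U' : Site d → Fin d → (Matrix n n ℂ)ˣ)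
  (hWP : IsPeriodicCfg W ((tower L N (k + 1) : ℕ) : ℤ)) (hU'u : IsUnitaryCfg U') (hU'P : IsPeriodicCfg U' ((tower L N (k + 1) : ℕ) : ℤ))
  (hA : curvSum d L (k + 1) x ≤ 2 / 3 * L)
  {x' : ℝ} (hx'0 : 0 ≤ x') (hs' : LevelSmall d L k x') (hU'x : SmallField U' x')
  (htop : cavgIter L (k + 1) U' = cavgIter L (k + 1) W)
  {u : Site d → (Matrix n n ℂ)ˣ} (hu : IsUnitarySite u) (huP : IsPeriodicSite u ((tower L N (k + 1) : ℕ) : ℤ))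
  (hgauge : gaugeAct u U' = vary W (repLog W U' u) 1) (hX8 : ∀ y κ, ‖repLog W U' u y κ‖ ≤ 1 / 8)
  (hcorner : ∀ z, ((u (((L : ℤ) ^ (k + 1)) • z) : (Matrix n n ℂ)ˣ) : Matrix n n ℂ) = exp (cornerLog L k u z))
  -- the fine gauge field reading the corner logs
  {Λ : Site d → Matrix n n ℂ} (hΛ : ∀ y, Λ y ∈ skewAdjoint (Matrix n n ℂ))
  (hΛP : ∀ (y : Site d) (i : Fin d), Λ (y + ((tower L N (k + 1) : ℕ) : ℤ) • e i) = Λ y)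
  (hread : ∀ z, Λ (((L : ℤ) ^ (k + 1)) • z) = cornerLog L k u z)

variable (hΛs : ∀ y, ‖Λ y‖ < 1 / 64) (hRs : ∀ y μ, ‖(repLog W U' u y μ - gaugeDir W Λ y μ)‖ < 1 / 64)
  {r : ℝ} (hr : ∀ (y : Site d) (μ : Fin d), ‖gaugeExtract W Λ (fun y μ => repLog W U' u y μ - gaugeDir W Λ y μ) y μ‖ ≤ r) (hr1 : r ≤ 1)
  (hσr : 4 * (3 + 12 * (d : ℝ)) ^ 2 * (L : ℝ) ^ (k + 1) * r ≤ rho0 d L ^ 2) (hsmU : LevelSmall d L k (x + 8 * r))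

  (hd : 1 ≤ d) (hN : 1 ≤ N) (hA1 : ((L : ℝ) ^ d / L * (d * (2 * nbRad d L + 1) ^ d)) * curvSum d L (k + 1) x ≤ 2 / 3)

include hL hWu hx hsK hWx hWP hU'u hU'P hA hx'0 hs' hU'x htop hu huP hgauge hX8 hcorner hΛ hΛP hread hΛs hRs hr hr1 hσr hsmU hd hN hA1 in
/-- **(DL1) REDUCED**: in the setting of `NE7SliceCoarseDatumStraight` ((S1) state on the shifted fibre; `Λ` reading the corner logs; `R = X(u) − gaugeDir W Λ`;
`R′ = gaugeExtract W Λ R` of sup `r ≤ 1` on the σ-line; enlarged class), with `d ≥ 1`, `N ≥ 1` and the `ℓ¹` curvature line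
`(L^d∕L·d(2nbRad+1)^d)·curvSum d L (k+1) x ≤ 2∕3`:
`dirL1 φ(u) (periodBox N) ≤ C₁ · ( Σ_{i≤k} dirL1 (E_i(R′)) (periodBox (L^{k−i}·N)) + dirL1 (R′ − R) (periodBox (L^{k+1}·N)) )`, `C₁ = C₁(d,L,k+1)` written out. [folklore] -/
theorem dirL1_coarseDatum_le :
    dirL1 (coarseDatum L k W U' u) (periodBox (d := d) N)
      ≤ (3 + 2 * (d : ℝ) * (((d : ℝ) * L) * (2 * nbRad d L + 1) ^ d * (3 * ∑ m ∈ range (k + 1), ((L : ℝ) / (L : ℝ) ^ d) ^ m)))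
        * (∑ i ∈ range (k + 1),
              dirL1 (fun z κ => relStep L (cavgIter L i W) (relIter L i W (gaugeExtract W Λ (fun y μ => repLog W U' u y μ - gaugeDir W Λ y μ))) z κ
                  - cpush L (cavgIter L i W) (relIter L i W (gaugeExtract W Λ (fun y μ => repLog W U' u y μ - gaugeDir W Λ y μ))) z κ)
                (periodBox (d := d) (L ^ (k + 1 - 1 - i) * N))
            + dirL1 (fun y μ => gaugeExtract W Λ (fun y μ => repLog W U' u y μ - gaugeDir W Λ y μ) y μ - (repLog W U' u y μ - gaugeDir W Λ y μ))
                (periodBox (d := d) (L ^ (k + 1) * N))) := by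
  have hL1 : 1 ≤ L := by omega
  have hr0 : 0 ≤ r := (norm_nonneg _).trans (hr 0 ⟨0, by omega⟩)
  have hWP' : IsPeriodicCfg W ((L ^ (k + 1) * N : ℕ) : ℤ) := by rw [← tower_eq_pow_mul]; exact hWP
  have hΛP' : ∀ (y : Site d) (i : Fin d), Λ (y + ((L ^ (k + 1) * N : ℕ) : ℤ) • e i) = Λ y := by rw [← tower_eq_pow_mul]; exact hΛP
  -- class facts of `R` and `R′`
  have hXsk := repLog_skew hWu U' hU'u hu hgauge hX8
  have hRsk : IsSkewDir (fun y μ => repLog W U' u y μ - gaugeDir W Λ y μ) := fun y μ =>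
    (skewAdjoint (Matrix n n ℂ)).sub_mem (hXsk y μ)
      ((skewAdjoint (Matrix n n ℂ)).sub_mem
        (AveragingDeficitTransport.Ad_mem_skewAdjoint ((unitaryUnits (Matrix n n ℂ)).inv_mem (hWu y μ)) (hΛ y)) (hΛ (y + e μ)))
  have hRP : IsPeriodicDir (fun y μ => repLog W U' u y μ - gaugeDir W Λ y μ) ((L ^ (k + 1) * N : ℕ) : ℤ) := by
    intro y i μ
    have hX := repLog_periodic k N U' hWP hU'P huP y i μ
    have hG := isPeriodicDir_gaugeDir hWP hΛP y i μ
    rw [tower_eq_pow_mul] at hX hG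
    simp only [hX, hG]
  have hR's : IsSkewDir (gaugeExtract W Λ (fun y μ => repLog W U' u y μ - gaugeDir W Λ y μ)) := isSkewDir_gaugeExtract hWu hΛ hRsk hΛs hRs
  have hR'P : IsPeriodicDir (gaugeExtract W Λ (fun y μ => repLog W U' u y μ - gaugeDir W Λ y μ)) ((L ^ (k + 1) * N : ℕ) : ℤ) := isPeriodicDir_gaugeExtract hWP' hΛP' hRP
  -- the defect `R′ − R` is skew periodic
  have hDs : IsSkewDir (fun y μ => gaugeExtract W Λ (fun y μ => repLog W U' u y μ - gaugeDir W Λ y μ) y μ - (repLog W U' u y μ - gaugeDir W Λ y μ)) :=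
    fun y μ => (skewAdjoint (Matrix n n ℂ)).sub_mem (hR's y μ) (hRsk y μ)
  have hDP : IsPeriodicDir (fun y μ => gaugeExtract W Λ (fun y μ => repLog W U' u y μ - gaugeDir W Λ y μ) y μ - (repLog W U' u y μ - gaugeDir W Λ y μ)) ((tower L N (k + 1) : ℕ) : ℤ) := by
    intro y i μ
    have h1 := hR'P y i μ
    have h2 := hRP y i μ
    rw [← tower_eq_pow_mul] at h1 h2
    simp only [h1, h2]
  -- (1) the exact form of the coarse datum
  have hφ : coarseDatum L k W U' u = fun z κ =>
      -(relIter L (k + 1) W (gaugeExtract W Λ (fun y μ => repLog W U' u y μ - gaugeDir W Λ y μ)) z κ - dirIter L (k + 1) W (gaugeExtract W Λ (fun y μ => repLog W U' u y μ - gaugeDir W Λ y μ)) z κ)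
        + -dirIter L (k + 1) W (fun y μ => gaugeExtract W Λ (fun y μ => repLog W U' u y μ - gaugeDir W Λ y μ) y μ - (repLog W U' u y μ - gaugeDir W Λ y μ)) z κ := by
    funext z κ
    rw [coarseDatum_eq_neg_quadRem_sub hL k hWu hx hsK hWx N U' hWP hU'u hU'P hA hx'0 hs' hU'x htop hu huP hgauge hX8 hcorner hΛ hΛP hread hΛs hRs hr
      hr1 hσr hsmU z κ, sub_eq_add_neg]
  rw [hφ]
  have hadd : ∀ (A B : Site d → Fin d → Matrix n n ℂ) (F : Finset (Site d)),
      dirL1 (fun z κ => A z κ + B z κ) F ≤ dirL1 A F + dirL1 B F := by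
    intro A B F
    unfold dirL1
    rw [← Finset.sum_add_distrib]
    refine Finset.sum_le_sum fun z _ => ?_
    rw [← Finset.sum_add_distrib]
    exact Finset.sum_le_sum fun κ _ => norm_add_le _ _
  have hneg : ∀ (A : Site d → Fin d → Matrix n n ℂ) (F : Finset (Site d)), dirL1 (fun z κ => -A z κ) F = dirL1 A F := by
    intro A F; unfold dirL1; simp only [norm_neg]
  refine (hadd _ _ _).trans ?_
  rw [hneg, hneg]
  -- (2) the quadratic remainder of `R′` in ℓ¹
  have hQ := dirL1_relIter_sub_dirIter_le (K := k + 1) hd hL hN hWu hWP' hx hsK hWx hA hA1 hR's hR'P hr0 hr hσr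
  -- (3) the push of the defect in ℓ¹
  have hD := dirL1_dirIter_le hL1 hN k hWu hWP hx (levelSmall_pred k hsK) hWx hDs hDP hA1
  rw [tower_eq_pow_mul] at hD
  have hD' := hD.trans (mul_le_mul_of_nonneg_right (pushConst_le_l1PushC (d := d) (K := k + 1) hd hL1 le_rfl) (dirL1_nonneg _ _))
  rw [mul_add]
  exact add_le_add hQ hD'

end State

end

end Summit.QuantumFields.BalabanUV.T4Continuum.NE7CoarseDatumL1Reduction
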